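import Summits.CriticalPhenomena.SAWScalingLimit.Theses.SAWRenewalTightness
import Summits.CriticalPhenomena.SAWScalingLimit.Theorems.SAWRenewalTightnessShellCrossingBoundTravCount
import Summits.CriticalPhenomena.SAWScalingLimit.Theorems.SAWRenewalTightnessShellCrossingBoundSocketNesting
import Summits.CriticalPhenomena.SAWScalingLimit.Theorems.ShellCrossingBound.Negative.UniformThresholdFalse
import Summits.CriticalPhenomena.SAWScalingLimit.Theorems.ShellCrossingBound.Negative.OfEventualTight
import Literature.Probability.RandomPlanarGeometry.CurveTortuosity
import Literature.Probability.RandomPlanarGeometry.SAWRestrictionCovariance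
import Literature.Probability.RandomPlanarGeometry.PinchUnionBound

/-!
# Line `socket-comparison` — skeleton for the crux `SAWRenewalTightness.ShellCrossingBound`

Crux item stmt-CriticalPhenomena-4728 (rank 2 of `route-CriticalPhenomena-SAWRenewalTightness`,
shared as support by `route-CriticalPhenomena-SAWEdgeOfPositiveType`); crux-plan round 1 for the
idea card `Cruxes/ShellCrossingBound/Ideas/socket-comparison.md` (ideator 2), triage r1-1/2/3:
pass (auxiliary to `pinch-on-a-circle`; two typing repairs demanded — both made here).  Line card:
`Lines/socket-comparison.md`.

Crux (FIXED, concluded BY NAME by `ShellCrossingBound_of`): for every Dobrushin domain `D` and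
endpoint approximation `(a_δ, b_δ)` there are a SHELL-DEPENDENT threshold `k x ρ R`, constants
`K`, `λ > 2`, `δ₀ > 0` with `P_δ[k x ρ R separate traversals of D(x; ρ, R)] ≤ K (ρ/R)^λ` for
`δ ≤ δ₀`, `δ ≤ ρ < R ≤ 1`.

## Calibration (standing `Disproof.lean`, cdisprove cycle 1; landed `Negative/OfEventualTight`,
## `Negative/RadiiThreshold`, `Negative/UniformThresholdFalse`, all imported above)

* `shellCrossingBound_of_eventualTight` / `targets_of_isTightMeasureSet`: with a per-shell
  threshold the crux is EQUIVALENT to the target `EventualTight`; `K`, `λ > 2`, `δ ≤ ρ`, `R ≤ 1`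
  are decorative.  HONOURED: the skeleton reaches the crux through per-shell decay of the
  traversal count (`PerShellDecay`, `K = 1`, `λ = 3`, `δ₀ = 1`) and puts CONTENT into ONE stub with a
  FIXED threshold `k = 4` and a power law (`SocketPinchBound`), which tightness does not imply.
* `Negative.not_uniformThreshold` (= `not_shellCrossingBoundUniformK`, the sheared-sine forcing
  domain): a threshold uniform over ALL shells is FALSE — forcing lives at the marked point `a`.
  HONOURED: the only fixed-threshold stub (`SocketPinchBound`) excludes the balls `B(a, 3r)`,
  `B(b, 3r)` about the marked points and lives in the ENLARGED domain, whose boundary away from the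
  sockets is a round circle; no stub is an instance of the refuted uniform statement.
* Disproof §5 (`ShellCrossingBoundBulk`, `k₀ = 3` false at the starting point, `k₀ = 4` predicted):
  the fixed threshold used is `4`, and the shells of `SocketPinchBound` never contain the start
  `δ·a_δ` (it lies in `B(a, r)` for `δ ≤ δ₀(r)`, the shells in `ℂ ∖ B(a, 2r)`).
* No `_false_without_<H>` theorem exists for this crux (Disproof §3: recorded as a finding).
  Negatives index (9 on the summit): only stmt-0772 (all-`δ` tightness) is nearby; every stub keeps
  an `∃ δ₀` / eventual quantifier or is scale-free.

## LEAD STATUS (v4, 2026-08-16; lead prover-line-stmt-CriticalPhenomena-4728-0) — read this first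

    ShellCrossingBound                              (K = 1, λ = 3, global δ₀ = 1; `ShellCrossingBound_of`)
      ⇐ PerShellDecay ∧ TravCountBound             `bound_of_perShellDecay` (proved) + S1 LANDED p81647
      ⇐ PinchAway D a b                              S6 `pinchUnionBound_holds` (proved; Literature `CurvePinch` p89577,
                                                     `PinchUnionBound` generalized form)
      =: S0 `stub_pinchAway`  — THE SINGLE REGISTERED SUFFICIENT STUB (OPEN, crux-sized: a fixed-threshold
         (k = 4) two-strand arm estimate with exponent > 1 for the critical ℤ² SAW, d-away from the marks)
      ⇐ SocketNesting ∧ RestrictionCovariance ∧ SocketConfinement ∧ SocketPinchBound    `pinchAway_of` (proved)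
         S2 LANDED p86740   S3 LANDED (Literature     S4 `stub_socketConfinement`  S5 `stub_socketPinchBound`
                            SAWRestrictionCovariance   (OPEN, registered)           (OPEN, registered)
                            p88835)
  Registered stubs on the item: stub_pinchAway (S0), stub_socketConfinement (S4), stub_socketPinchBound (S5);
  S4 ∧ S5 ⟹ S0 is kernel-checked, so landing S0 alone OR S4 and S5 closes the crux.  Hand-back analysis:
  `Cruxes/ShellCrossingBound/LeadSocketComparison.md`.

## The line as planned (crux-plan round 1: 4 stubs + 2 proved rungs; kept for the record)

THE LEVER (card): the `x_c`-law is configurational, so for nested discrete domains it obeys EXACT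
restriction covariance `P_{Ω'}(E) · P_Ω(γ is an Ω'-walk) = P_Ω(E ∧ γ is an Ω'-walk) ≤ P_Ω(E)`;
every unconditional UPPER bound transfers from a big domain `Ω` to a sub-domain `Ω'` at the price
of the confinement probability.  THE MOVE: enlarge an arbitrary Dobrushin domain `D'` to the
SOCKETED DISC `Ω = socketDomain D' L r := D' ∪ (B(0, L) ∖ (B̄(a, r) ∪ B̄(b, r)))` — outside the two
closed socket balls `Ω` IS the disc minus two round plugs (its boundary there is the circle
`|z| = L`, far from `D̄' ⊆ B(0, L/2)`), inside the open socket balls `Ω = D'` exactly (same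
boundary germs at the marked points, which is what keeps `Z_{D'}/Z_Ω` of order one), and
`Ω ∖ D'` is at distance `≥ r` from both marked points.  No Jordan curve is built: `SAW.law` takes a
carrier SET, so the enlargement is a definition, not a stub.

* S1 `stub_travCount` (`TravCountBound`; deterministic, provable now, M): a self-avoiding
  polyline of mesh `δ ≥ δ₁` makes fewer than `N(ρ, δ₁)` separate traversals of any shell of inner
  radius `ρ` (inward traversals end on distinct edges meeting `B̄(x, ρ)`, by convexity of the
  distance along an edge; the walk is a path, so these are distinct lattice edges:
  `N = 2·#{edges of δℤ² meeting a ρ-ball} + 1 ≤ 8 (2ρ/δ₁ + 3)² + 1`).  It absorbs EVERY coarse-mesh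
  case, which is why all other stubs may carry shell-, radius- or domain-dependent mesh thresholds.
* S2 `stub_socketNesting` (`SocketNesting`; lattice topology, provable now, L): for small `δ`
  every `D'_δ`-walk `a_δ → b_δ` is an `Ω_δ`-walk with the same support (edges: `D̄' ⊆ Ω̄`;
  vertices: `meshDomain D' δ` is the bulk component of `D'` —
  `JordanDomain.exists_forall_mem_meshDomain_and_reachable` — and the bulk of the disc minus plugs
  is the unique largest `Ω`-component, every stray `Ω`-component living in the socket balls where
  `Ω = D'`).  Triage repair (b) of r1-1: nesting is only EVENTUAL in `δ`; typed so.
* S3 `RestrictionCovariance` — PROVED in this file (`restrictionCovariance_holds`, sorry-free; the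
  card's lever, kernel-checked): `law Ω' E · law Ω (Conf Ω') ≤ law Ω E` for curve events `E`, under
  graph nesting (two injections of countable sums + `Z'⁻¹ Z' ≤ 1`; every junk case included).
  Triage repair (a) of r1-1/r1-2/r1-3: the confinement event is "the support is the support of an
  `Ω'_δ`-WALK" (vertices AND edges), not vertex containment.
* S4 `stub_socketConfinement` (`SocketConfinement`; OPEN, rate-free — the card's atom
  `ConfinementPositivity` specialised to the socketed disc): `P_Ω[γ is a D'_δ-walk] ≥ c > 0` for
  `δ ≤ δ₀`.  Predicted by SLE₈⸝₃ restriction (the obstacle `Ω ∖ D'` is `r`-far from `a, b`);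
  numerically the band test of the card (0.32/0.28 at mesh 1/64 vs `(√2−1)^{5/4} = 0.332`).
* S5 `stub_socketPinchBound` (`SocketPinchBound`; OPEN, HARDEST — the SAW estimate): in the
  socketed disc, FOUR separate traversals of `D(y; η, R)` cost `≤ C (η/R)^{1+s}` for centres `y`
  with `dist(y, a), dist(y, b) ≥ 3r`, radii `δ ≤ η < R ≤ R₀`, mesh `δ ≤ δ₀` (all constants may depend
  on `D', L, r`).  This is `pinch-on-a-circle`'s atom UTSP moved to the one domain where its shells
  see no wild boundary at all: with `R₀ ≤ r` they avoid the plugs, so they are bulk shells of a disc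
  or flat-boundary shells at `|z| = L` (predicted exponents `x₄ = 35/12`, boundary `7`; threshold
  `1 + s`).
* S6 `PinchUnionBound` — PROVED in this file (`pinchUnionBound_holds`, sorry-free; the union-bound
  rung of `pinch-on-a-circle`, closed as triage r1-1 asked): a two-strand pinch bound away from the
  marked points in `D'` gives per-shell decay of the traversal count (three sub-shells keep the
  middle circle `(R−ρ)/12` away from `a, b` — `exists_good_mid`; pigeonhole on the middle circle —
  `exists_pinch_of_hasTraversals` (ideator 2); net of `k` points — `exists_dist_netPt_le`;
  `measure_iUnion_fintype_le`; `k · C'(η/R')^{1+s} = C'(6πμ/R')(η/R')^s ≤ ε`).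
* Composition (no `sorry`): S2, S3 (proved), S4, S5 ⟹ `PinchAway D'` (restriction transfer with `r = min(d/3,
  |a−b|/8)`, constant `C/c`); S6 (proved) ⟹ `PerShellDecay D'`; S1 ⟹ global mesh threshold `δ₀ = 1`
  and the crux with `K = 1`, `λ = 3` (`ShellCrossingBound_of`).  OPEN after this file: S1, S2
  (provable now), S4, S5 (the two SAW statements).

Namespace `…Cruxes.ShellCrossingBound.SocketComparison`; statements over tree vocabulary
(`SAW.law`, `SAW.DomainSAW`, `SAW.IsEndpointApprox`, `meshPoint`, `Curve.HasTraversals`,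
`MarkedDomain.pt`, `Metric.ball/closedBall`) plus the local `def`s `trav`, `Conf`, `Nested`,
`socketDomain`, `IsSocket`, `PinchAway`, `PerShellDecay`.
-/

noncomputable section

open MeasureTheory Set Metric Filter Topology
open scoped ENNReal
open Literature.Probability.RandomPlanarGeometry Literature.Probability.LatticeModels
open Summit.CriticalPhenomena.SAWScalingLimit.Theses.SAWRenewalTightness (ShellCrossingBound)

namespace Summit.CriticalPhenomena.SAWScalingLimit.Cruxes.ShellCrossingBound.SocketComparison

/-! ### Vocabulary of the line -/

/-- The Aizenman–Burchard event under the critical SAW law of `Ω_δ` from `u` to `v`: the SAW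
polyline (verbatim the crux's curve `⟨γ.walk.toCurve (meshPoint δ)⟩`) makes `k` separate
traversals of the shell `D(y; η, R)`. -/
def trav (Ω : Set ℂ) (δ : ℝ) (u v : Site 2) (k : ℕ) (y : ℂ) (η R : ℝ) :
    Set (SAW.DomainSAW Ω δ u v) :=
  {γ | (⟨γ.walk.toCurve (meshPoint δ)⟩ : Curve ℂ).HasTraversals k y η R}

/-- **Confinement event** (triage-repaired typing): the `Ω_δ`-walk `γ` IS a walk of the sub-domain
`Ω'_δ` — its support is the support of some self-avoiding walk of `discreteDomainGraph Ω' δ`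
(vertices AND edges of `Ω'_δ`; vertex containment alone is the wrong event for wild `Ω'`). -/
def Conf (Ω' Ω : Set ℂ) (δ : ℝ) (u v : Site 2) : Set (SAW.DomainSAW Ω δ u v) :=
  {γ | ∃ γ' : SAW.DomainSAW Ω' δ u v, γ'.walk.support = γ.walk.support}

/-- **Graph nesting at mesh `δ`**: every self-avoiding walk of `Ω'_δ` from `u` to `v` is (the
support of) a self-avoiding walk of `Ω_δ`.  The hypothesis of restriction covariance. -/
def Nested (Ω' Ω : Set ℂ) (δ : ℝ) (u v : Site 2) : Prop :=
  ∀ γ' : SAW.DomainSAW Ω' δ u v, ∃ γ : SAW.DomainSAW Ω δ u v, γ.walk.support = γ'.walk.support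

/-- **The socketed disc** of a Dobrushin domain `D = (D'; a, b)`: `D'` together with the open disc
`B(0, L)` minus the two closed socket balls `B̄(a, r)`, `B̄(b, r)`.  Inside the open socket balls it
coincides with `D'` (same boundary germs at the marked points); outside the closed socket balls it
is the disc minus two round plugs; `Ω ∖ D'` is at distance `≥ r` from `a` and `b`. -/
def socketDomain (D : DobrushinDomain) (L r : ℝ) : Set ℂ :=
  D.carrier ∪ (ball (0 : ℂ) L \ (closedBall (D.pt 0) r ∪ closedBall (D.pt 1) r))

/-- Admissible socket parameters: the disc is large (`D̄' ⊆ B(0, L/2)`), the socket radius is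
positive and small against the distance of the marked points (so the two plugs are far apart
and `D'` sticks out of both socket balls). -/
def IsSocket (D : DobrushinDomain) (L r : ℝ) : Prop :=
  closure D.carrier ⊆ ball (0 : ℂ) (L / 2) ∧ 0 < r ∧ 8 * r ≤ dist (D.pt 0) (D.pt 1)

/-- **Two-strand pinch bound away from the marked points** in the ORIGINAL domain (the transferred
estimate; `pinch-on-a-circle`'s UTSP with a distance-dependent mesh threshold and the mesh clause
`δ ≤ η`): for every `d > 0` there are `C, s > 0, R₀ > 0, δ₁ > 0` with
`P_δ[4 separate traversals of D(y; η, R)] ≤ C (η/R)^{1+s}` for `δ ≤ δ₁`, `δ ≤ η < R ≤ R₀` and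
centres `y` at distance `≥ d` from both marked points. -/
def PinchAway (D : DobrushinDomain) (a b : ℝ → Site 2) : Prop :=
  ∀ d : ℝ, 0 < d → ∃ (C s R₀ δ₁ : ℝ), 0 < s ∧ 0 < R₀ ∧ 0 < δ₁ ∧
    ∀ δ ∈ Set.Ioc (0 : ℝ) δ₁, ∀ (y : ℂ) (η R : ℝ), δ ≤ η → η < R → R ≤ R₀ →
      d ≤ dist y (D.pt 0) → d ≤ dist y (D.pt 1) →
        SAW.law D.carrier δ (a δ) (b δ) (trav D.carrier δ (a δ) (b δ) 4 y η R)
          ≤ ENNReal.ofReal (C * (η / R) ^ (1 + s))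

/-- **Per-shell decay of the traversal count** (shell-dependent mesh threshold): for every genuine
shell and `ε > 0` some number `k` of separate traversals has probability `≤ ε` for all small
meshes.  With S1 this is all the crux asks (calibration: crux ⟺ `EventualTight`). -/
def PerShellDecay (D : DobrushinDomain) (a b : ℝ → Site 2) : Prop :=
  ∀ (x : ℂ) (ρ R : ℝ), 0 < ρ → ρ < R → ∀ ε : ℝ, 0 < ε → ∃ (k : ℕ) (δ₁ : ℝ), 0 < δ₁ ∧
    ∀ δ ∈ Set.Ioc (0 : ℝ) δ₁,
      SAW.law D.carrier δ (a δ) (b δ) (trav D.carrier δ (a δ) (b δ) k x ρ R) ≤ ENNReal.ofReal ε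

/-! ### The six statements of the line (named `Prop`s; S3 and S6 are proved below, the other four are the stubs) -/

/-- **S1 — coarse meshes are free** (deterministic).  For `ρ, δ₁ > 0` there is `N` such that at
every mesh `δ ≥ δ₁`, in every domain and for every pair of endpoints, NO self-avoiding polyline
makes `N` separate traversals of a shell `D(x; ρ, R)` with `ρ < R` (any centre, any outer radius).
Proof sketch: an inward traversal ends at a point of `B̄(x, ρ)` on some edge of the polyline; two
inward traversals ending on the same edge would force the (convex) distance to `x` along that edge
to exceed `R > ρ` between two values `≤ ρ`; the edges of a path are distinct lattice edges, and at
most `4 (2ρ/δ₁ + 3)²` edges of `δℤ²` meet a `ρ`-ball; same for outward traversals. -/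
def TravCountBound : Prop :=
  ∀ (ρ δ₁ : ℝ), 0 < ρ → 0 < δ₁ → ∃ N : ℕ, ∀ (Ω : Set ℂ) (δ : ℝ) (u v : Site 2)
    (γ : SAW.DomainSAW Ω δ u v) (x : ℂ) (R : ℝ), δ₁ ≤ δ → ρ < R →
      ¬ (⟨γ.walk.toCurve (meshPoint δ)⟩ : Curve ℂ).HasTraversals N x ρ R

/-- **S2 — socket nesting** (lattice topology, eventual in the mesh).  For a Dobrushin domain with
an endpoint approximation and admissible socket parameters, for all small `δ` every self-avoiding
walk of `D'_δ` from `a_δ` to `b_δ` is a self-avoiding walk of the socketed disc `Ω_δ`. -/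
def SocketNesting : Prop :=
  ∀ (D : DobrushinDomain) (a b : ℝ → Site 2), SAW.IsEndpointApprox D a b →
    ∀ (L r : ℝ), IsSocket D L r → ∃ δ₁ : ℝ, 0 < δ₁ ∧ ∀ δ ∈ Set.Ioc (0 : ℝ) δ₁,
      Nested D.carrier (socketDomain D L r) δ (a δ) (b δ)

/-- **S3 — restriction covariance of the critical SAW law** (exact; stated as the inequality the
transfer consumes; PROVED below, `restrictionCovariance_holds`).  If every `Ω'_δ`-walk `u → v` is an `Ω_δ`-walk, then for every set `E` of
curves `law Ω' {curve ∈ E} · law Ω (Conf Ω') ≤ law Ω {curve ∈ E}`: indeed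
`law Ω' (E) = W'(E)/Z'`, `law Ω (Conf Ω') = Z'/Z`, and the `Ω'`-walks in `E` are `Ω`-walks in `E`
with the same weight `x_c^{|γ|}` and the same polyline (`toCurve` depends on the support only);
junk cases (`Z` or `Z'` zero or infinite) give `0` on the left. -/
def RestrictionCovariance : Prop :=
  ∀ (Ω' Ω : Set ℂ) (δ : ℝ) (u v : Site 2) (E : Set (Curve ℂ)), Nested Ω' Ω δ u v →
    SAW.law Ω' δ u v {γ' | (⟨γ'.walk.toCurve (meshPoint δ)⟩ : Curve ℂ) ∈ E} *
        SAW.law Ω δ u v (Conf Ω' Ω δ u v) ≤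
      SAW.law Ω δ u v {γ | (⟨γ.walk.toCurve (meshPoint δ)⟩ : Curve ℂ) ∈ E}

/-- **S4 — socket confinement positivity** (OPEN, rate-free; the card's atom for the socketed
disc).  The critical SAW of the socketed disc `Ω` from `a_δ` to `b_δ` IS a walk of `D'_δ` with
probability `≥ c > 0`, uniformly in `δ ≤ δ₀` (`c, δ₀` depending on `D', a, b, L, r`).  The content
is `liminf_{δ→0} Z_{D'}(a_δ,b_δ)/Z_Ω(a_δ,b_δ) > 0`; on any `[δ₁, δ₀]` it is elementary. -/
def SocketConfinement : Prop :=
  ∀ (D : DobrushinDomain) (a b : ℝ → Site 2), SAW.IsEndpointApprox D a b →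
    ∀ (L r : ℝ), IsSocket D L r → ∃ c δ₀ : ℝ, 0 < c ∧ 0 < δ₀ ∧ ∀ δ ∈ Set.Ioc (0 : ℝ) δ₀,
      ENNReal.ofReal c ≤
        SAW.law (socketDomain D L r) δ (a δ) (b δ) (Conf D.carrier (socketDomain D L r) δ (a δ) (b δ))

/-- **S5 — two-strand pinch bound in the socketed disc, away from the sockets** (OPEN, HARDEST).
In `Ω = socketDomain D' L r`: four separate traversals of `D(y; η, R)` by the critical SAW from
`a_δ` to `b_δ` have probability `≤ C (η/R)^{1+s}` whenever `δ ≤ η < R ≤ R₀`, `δ ≤ δ₀` and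
`dist(y, a), dist(y, b) ≥ 3r`.  Choosing `R₀ ≤ r`, every such shell misses the plugs: it is a bulk
shell of the disc or a shell at the round outer boundary.  A fixed-threshold (`k = 4`) arm bound —
content beyond tightness — in the nicest domain the socket move can offer. -/
def SocketPinchBound : Prop :=
  ∀ (D : DobrushinDomain) (a b : ℝ → Site 2), SAW.IsEndpointApprox D a b →
    ∀ (L r : ℝ), IsSocket D L r → ∃ (C s R₀ δ₀ : ℝ), 0 < s ∧ 0 < R₀ ∧ 0 < δ₀ ∧
      ∀ δ ∈ Set.Ioc (0 : ℝ) δ₀, ∀ (y : ℂ) (η R : ℝ), δ ≤ η → η < R → R ≤ R₀ →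
        3 * r ≤ dist y (D.pt 0) → 3 * r ≤ dist y (D.pt 1) →
          SAW.law (socketDomain D L r) δ (a δ) (b δ)
              (trav (socketDomain D L r) δ (a δ) (b δ) 4 y η R) ≤
            ENNReal.ofReal (C * (η / R) ^ (1 + s))

/-- **S6 — the pinch union bound** (`pinch-on-a-circle`'s second rung; PROVED below, `pinchUnionBound_holds`).  A
two-strand pinch bound away from the marked points gives per-shell decay of the traversal count:
for `D(x; ρ, R)` pick one of the three sub-shells of width `(R−ρ)/3` whose middle circle is at
distance `≥ (R−ρ)/12 =: d` from both marked points (`HasTraversals.mono'`), apply the pigeonhole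
`exists_pinch_of_hasTraversals` (PROVED below) and move the pinch centre to one of `k` equally
spaced net points (`HasTraversals.mono`, chord ≤ arc), shrink the outer radius to `min((R−ρ)/12,
R₀ d)` (`mono'`), and sum: `P(k traversals) ≤ k · C (5π r_mid /(k R'))^{1+s} → 0`; take
`δ₁ = min(δ₁(d), η_k)` so that the mesh clause `δ ≤ η_k` holds. -/
def PinchUnionBound : Prop :=
  ∀ (D : DobrushinDomain) (a b : ℝ → Site 2), PinchAway D a b → PerShellDecay D a b

/-! ### The stubs (the ONLY `sorry`s of the file)

Lead's reshape (2026-08-16, registration v2): every stub is stated over TREE VOCABULARY ONLY (the local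
`def`s `trav`, `Conf`, `Nested`, `socketDomain`, `IsSocket` unfolded by hand), so that each lands verbatim as
`Theorems/SAWRenewalTightnessShellCrossingBound<Stub>.lean --supports stmt-CriticalPhenomena-4728` without
importing this workfile; `*_holds` below certify definitionally that the unfolded text IS the named statement. -/

/-- S1 (deterministic; LANDED p81647 as `Theorems.stub_travCount`,
`Theorems/SAWRenewalTightnessShellCrossingBoundTravCount.lean`): `= TravCountBound` verbatim. -/
theorem stub_travCount :
    ∀ (ρ δ₁ : ℝ), 0 < ρ → 0 < δ₁ → ∃ N : ℕ, ∀ (Ω : Set ℂ) (δ : ℝ) (u v : Site 2)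
      (γ : SAW.DomainSAW Ω δ u v) (x : ℂ) (R : ℝ), δ₁ ≤ δ → ρ < R →
        ¬ (⟨γ.walk.toCurve (meshPoint δ)⟩ : Curve ℂ).HasTraversals N x ρ R :=
  Theorems.stub_travCount

/-- S2 (lattice topology; LANDED p86740 as `Theorems.stub_socketNesting`,
`Theorems/SAWRenewalTightnessShellCrossingBoundSocketNesting.lean`, with the Literature helper file
`Literature/Probability/LatticeModels/MeshSocketedDisc.lean` p85342): `= SocketNesting` with `IsSocket`, `Nested`, `socketDomain`
unfolded. -/
theorem stub_socketNesting :
    ∀ (D : DobrushinDomain) (a b : ℝ → Site 2), SAW.IsEndpointApprox D a b →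
      ∀ (L r : ℝ), closure D.carrier ⊆ Metric.ball (0 : ℂ) (L / 2) ∧ 0 < r ∧
          8 * r ≤ dist (D.pt 0) (D.pt 1) →
        ∃ δ₁ : ℝ, 0 < δ₁ ∧ ∀ δ ∈ Set.Ioc (0 : ℝ) δ₁,
          ∀ γ' : SAW.DomainSAW D.carrier δ (a δ) (b δ),
            ∃ γ : SAW.DomainSAW (D.carrier ∪ (Metric.ball (0 : ℂ) L \
                (Metric.closedBall (D.pt 0) r ∪ Metric.closedBall (D.pt 1) r))) δ (a δ) (b δ),
              γ.walk.support = γ'.walk.support :=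
  Theorems.stub_socketNesting

/-- S4 (OPEN, rate-free): `= SocketConfinement` with `IsSocket`, `socketDomain`, `Conf` unfolded. -/
theorem stub_socketConfinement :
    ∀ (D : DobrushinDomain) (a b : ℝ → Site 2), SAW.IsEndpointApprox D a b →
      ∀ (L r : ℝ), closure D.carrier ⊆ Metric.ball (0 : ℂ) (L / 2) ∧ 0 < r ∧
          8 * r ≤ dist (D.pt 0) (D.pt 1) →
        ∃ c δ₀ : ℝ, 0 < c ∧ 0 < δ₀ ∧ ∀ δ ∈ Set.Ioc (0 : ℝ) δ₀,
          ENNReal.ofReal c ≤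
            SAW.law (D.carrier ∪ (Metric.ball (0 : ℂ) L \
                (Metric.closedBall (D.pt 0) r ∪ Metric.closedBall (D.pt 1) r))) δ (a δ) (b δ)
              {γ | ∃ γ' : SAW.DomainSAW D.carrier δ (a δ) (b δ),
                γ'.walk.support = γ.walk.support} := by
  sorry

/-- S5 (OPEN, HARDEST): `= SocketPinchBound` with `IsSocket`, `socketDomain`, `trav` unfolded. -/
theorem stub_socketPinchBound :
    ∀ (D : DobrushinDomain) (a b : ℝ → Site 2), SAW.IsEndpointApprox D a b →
      ∀ (L r : ℝ), closure D.carrier ⊆ Metric.ball (0 : ℂ) (L / 2) ∧ 0 < r ∧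
          8 * r ≤ dist (D.pt 0) (D.pt 1) →
        ∃ (C s R₀ δ₀ : ℝ), 0 < s ∧ 0 < R₀ ∧ 0 < δ₀ ∧
          ∀ δ ∈ Set.Ioc (0 : ℝ) δ₀, ∀ (y : ℂ) (η R : ℝ), δ ≤ η → η < R → R ≤ R₀ →
            3 * r ≤ dist y (D.pt 0) → 3 * r ≤ dist y (D.pt 1) →
              SAW.law (D.carrier ∪ (Metric.ball (0 : ℂ) L \
                  (Metric.closedBall (D.pt 0) r ∪ Metric.closedBall (D.pt 1) r))) δ (a δ) (b δ)
                  {γ | (⟨γ.walk.toCurve (meshPoint δ)⟩ : Curve ℂ).HasTraversals 4 y η R} ≤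
                ENNReal.ofReal (C * (η / R) ^ (1 + s)) := by
  sorry

/-- **S0 — THE SINGLE SUFFICIENT STATEMENT (lead reshape v4, 2026-08-16): the two-strand pinch
bound away from the marked points in the ORIGINAL domain** (`= ∀ D a b, IsEndpointApprox → PinchAway D a b`
with `trav` unfolded; OPEN).  This is exactly what the PROVED union-bound rung S6 consumes, so the
crux follows from it by kernel-checked glue alone (`ShellCrossingBound_of`); the socket transfer
(landed S2 + landed Literature restriction covariance + the open S4, S5) is ONE way to prove it
(`pinchAway_of`, proved below), recorded as the registered refinement S4 ∧ S5 ⟹ S0.  For every `d > 0`: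
`P_D[4 separate traversals of D(y; η, R)] ≤ C (η/R)^{1+s}` for `δ ≤ δ₁(d)`, `δ ≤ η < R ≤ R₀(d)` and
centres `y` at distance `≥ d` from both marked points (constants depending on `D, a, b, d`).  Predicted
(bulk `x₄ = 35/12`, boundary `7`); a fixed-threshold arm estimate for the critical planar SAW — none is
proved on any lattice. -/
theorem stub_pinchAway :
    ∀ (D : DobrushinDomain) (a b : ℝ → Site 2), SAW.IsEndpointApprox D a b →
      ∀ d : ℝ, 0 < d → ∃ (C s R₀ δ₁ : ℝ), 0 < s ∧ 0 < R₀ ∧ 0 < δ₁ ∧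
        ∀ δ ∈ Set.Ioc (0 : ℝ) δ₁, ∀ (y : ℂ) (η R : ℝ), δ ≤ η → η < R → R ≤ R₀ →
          d ≤ dist y (D.pt 0) → d ≤ dist y (D.pt 1) →
            SAW.law D.carrier δ (a δ) (b δ)
                {γ | (⟨γ.walk.toCurve (meshPoint δ)⟩ : Curve ℂ).HasTraversals 4 y η R} ≤
              ENNReal.ofReal (C * (η / R) ^ (1 + s)) := by
  sorry

/-! ### Consistency: each unfolded stub IS its named statement (definitionally) -/

/-- `TravCountBound` is the registered stub S1, verbatim. -/
theorem travCountBound_holds : TravCountBound := stub_travCount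
/-- `SocketNesting` is the registered stub S2, by unfolding `IsSocket`, `Nested`, `socketDomain`. -/
theorem socketNesting_holds : SocketNesting := stub_socketNesting
/-- `SocketConfinement` is the registered stub S4, by unfolding `IsSocket`, `socketDomain`, `Conf`. -/
theorem socketConfinement_holds : SocketConfinement := stub_socketConfinement
/-- `SocketPinchBound` is the registered stub S5, by unfolding `IsSocket`, `socketDomain`, `trav`. -/
theorem socketPinchBound_holds : SocketPinchBound := stub_socketPinchBound
/-- `PinchAway` (under the endpoint approximation) is the registered stub S0, by unfolding `trav`. -/
theorem pinchAway_holds : ∀ (D : DobrushinDomain) (a b : ℝ → Site 2), SAW.IsEndpointApprox D a b →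
    PinchAway D a b := stub_pinchAway

/-! ### Registered names of the stub statements

The skeleton audit admits as hypotheses of `ShellCrossingBound_of` only propositions whose head constant
is NAMED like a declared stub (the audit's stub attribute itself is gate-reserved), so each open statement gets a
reducible alias carrying its stub's name.  `Registered.stub_x` unfolds to the statement `X` by `rfl`. -/
namespace Registered

/-- `TravCountBound`, under the name of its stub. -/
abbrev stub_travCount : Prop := TravCountBound
/-- `SocketNesting`, under the name of its stub. -/
abbrev stub_socketNesting : Prop := SocketNesting
/-- `SocketConfinement`, under the name of its stub. -/
abbrev stub_socketConfinement : Prop := SocketConfinement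
/-- `SocketPinchBound`, under the name of its stub. -/
abbrev stub_socketPinchBound : Prop := SocketPinchBound
/-- `∀ D a b, IsEndpointApprox → PinchAway D a b`, under the name of its stub. -/
abbrev stub_pinchAway : Prop :=
  ∀ (D : DobrushinDomain) (a b : ℝ → Site 2), SAW.IsEndpointApprox D a b → PinchAway D a b

end Registered



/-! ### S3 is PROVED: restriction covariance of the critical SAW law (LANDED as Literature, p88835) -/

/-- **S3 PROVED — restriction covariance** (`RestrictionCovariance`): the landed
`SAW.law_mul_law_setOf_exists_support_eq_le` (`Literature/…/SAWRestrictionCovariance.lean`). -/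
theorem restrictionCovariance_holds : RestrictionCovariance :=
  fun _ _ _ _ _ E hN => SAW.law_mul_law_setOf_exists_support_eq_le hN E

/-! ### S6 is PROVED: the pinch union bound (`PinchAway → PerShellDecay`; LANDED in general form as Literature) -/

/-- **S6 PROVED — the pinch union bound** (`PinchUnionBound`): the landed
`perShellDecay_of_pinchBound` (`Literature/…/PinchUnionBound.lean`: pigeonhole on the middle circle
`Curve.exists_pinch_of_hasTraversals`, circle net, union bound) instantiated with the critical SAW laws,
the SAW polylines and the two marked points. -/
theorem pinchUnionBound_holds : PinchUnionBound := by
  intro D a b hPA x ρ R hρ hρR ε hε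
  exact perShellDecay_of_pinchBound (α := fun δ => SAW.DomainSAW D.carrier δ (a δ) (b δ))
    (fun δ => SAW.law D.carrier δ (a δ) (b δ))
    (fun δ γ => (⟨γ.walk.toCurve (meshPoint δ)⟩ : Curve ℂ)) (D.pt 0) (D.pt 1) hPA x hρ hρR hε

/-! ### Composition, part 1: the socket transfer (S2–S5 ⟹ `PinchAway`) -/

/-- The marked points of a Dobrushin domain are distinct, hence at positive distance. -/
theorem dist_pt_pos (D : DobrushinDomain) : 0 < dist (D.pt 0) (D.pt 1) := by
  refine dist_pos.2 fun h => ?_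
  have := D.pt_injective h
  exact absurd this (by decide)

/-- Every Dobrushin domain fits in a large disc: `D̄' ⊆ B(0, L/2)` for some `L`. -/
theorem exists_closure_subset_ball (D : DobrushinDomain) :
    ∃ L : ℝ, closure D.carrier ⊆ ball (0 : ℂ) (L / 2) := by
  obtain ⟨M, hM⟩ := (Metric.isBounded_iff_subset_ball (0 : ℂ)).1 D.isBounded.closure
  refine ⟨2 * M, ?_⟩
  have : (2 * M) / 2 = M := by ring
  rw [this]
  exact hM

/-- The ENNReal division step of the transfer: `p · c ≤ C q` with `c > 0` gives
`p ≤ (C / c) q`. -/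
theorem le_ofReal_div_of_mul_le {p : ℝ≥0∞} {c C q : ℝ} (hc : 0 < c)
    (h : p * ENNReal.ofReal c ≤ ENNReal.ofReal (C * q)) :
    p ≤ ENNReal.ofReal (C / c * q) := by
  have hc' : ENNReal.ofReal c ≠ 0 := (ENNReal.ofReal_pos.2 hc).ne'
  have h1 : p ≤ ENNReal.ofReal (C * q) / ENNReal.ofReal c := by
    rw [ENNReal.le_div_iff_mul_le (Or.inl hc') (Or.inl ENNReal.ofReal_ne_top)]
    exact h
  have h2 : C / c * q = C * q / c := by ring
  rw [h2, ENNReal.ofReal_div_of_pos hc]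
  exact h1

/-- **The socket transfer** (restriction covariance at work): nesting (S2), restriction
covariance (S3), confinement positivity (S4) and the pinch bound in the socketed disc (S5) give the
pinch bound away from the marked points in the ORIGINAL domain, with constant `C / c`.  For the
distance `d` the socket radius is `r = min (d/3) (|a − b|/8)`, so that `3 r ≤ d` and the socket is
admissible. -/
theorem pinchAway_of (h2 : SocketNesting) (h4 : SocketConfinement)
    (h5 : SocketPinchBound) (D : DobrushinDomain) (a b : ℝ → Site 2)
    (hab : SAW.IsEndpointApprox D a b) : PinchAway D a b := by
  have h3 : RestrictionCovariance := restrictionCovariance_holds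
  intro d hd
  obtain ⟨L, hL⟩ := exists_closure_subset_ball D
  have hdist := dist_pt_pos D
  set r : ℝ := min (d / 3) (dist (D.pt 0) (D.pt 1) / 8) with hr_def
  have hr : 0 < r := lt_min (by positivity) (by positivity)
  have hr8 : 8 * r ≤ dist (D.pt 0) (D.pt 1) := by
    have : r ≤ dist (D.pt 0) (D.pt 1) / 8 := min_le_right _ _
    linarith
  have hr3 : 3 * r ≤ d := by
    have : r ≤ d / 3 := min_le_left _ _
    linarith
  have hsock : IsSocket D L r := ⟨hL, hr, hr8⟩
  obtain ⟨δ₂, hδ₂, hnest⟩ := h2 D a b hab L r hsock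
  obtain ⟨c, δ₄, hc, hδ₄, hconf⟩ := h4 D a b hab L r hsock
  obtain ⟨C, s, R₀, δ₅, hs, hR₀, hδ₅, hpinch⟩ := h5 D a b hab L r hsock
  refine ⟨C / c, s, R₀, min δ₂ (min δ₄ δ₅), hs, hR₀, lt_min hδ₂ (lt_min hδ₄ hδ₅), ?_⟩
  intro δ hδ y η R hδη hηR hRR₀ hya hyb
  have hδ2 : δ ∈ Set.Ioc (0 : ℝ) δ₂ := ⟨hδ.1, hδ.2.trans (min_le_left _ _)⟩
  have hδ4 : δ ∈ Set.Ioc (0 : ℝ) δ₄ := ⟨hδ.1, hδ.2.trans ((min_le_right _ _).trans (min_le_left _ _))⟩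
  have hδ5 : δ ∈ Set.Ioc (0 : ℝ) δ₅ := ⟨hδ.1, hδ.2.trans ((min_le_right _ _).trans (min_le_right _ _))⟩
  set Ω : Set ℂ := socketDomain D L r with hΩ_def
  -- restriction covariance for the traversal event (S3 with `E = {4 traversals of D(y; η, R)}`)
  have hcov : SAW.law D.carrier δ (a δ) (b δ) (trav D.carrier δ (a δ) (b δ) 4 y η R) *
      SAW.law Ω δ (a δ) (b δ) (Conf D.carrier Ω δ (a δ) (b δ)) ≤
        SAW.law Ω δ (a δ) (b δ) (trav Ω δ (a δ) (b δ) 4 y η R) :=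
    h3 D.carrier Ω δ (a δ) (b δ) {γc : Curve ℂ | γc.HasTraversals 4 y η R} (hnest δ hδ2)
  -- the bound in the socketed disc (S5)
  have hbig : SAW.law Ω δ (a δ) (b δ) (trav Ω δ (a δ) (b δ) 4 y η R) ≤
      ENNReal.ofReal (C * (η / R) ^ (1 + s)) :=
    hpinch δ hδ5 y η R hδη hηR hRR₀ (hr3.trans hya) (hr3.trans hyb)
  -- confinement positivity (S4)
  have hpos : ENNReal.ofReal c ≤ SAW.law Ω δ (a δ) (b δ) (Conf D.carrier Ω δ (a δ) (b δ)) :=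
    hconf δ hδ4
  have key : SAW.law D.carrier δ (a δ) (b δ) (trav D.carrier δ (a δ) (b δ) 4 y η R) *
      ENNReal.ofReal c ≤ ENNReal.ofReal (C * (η / R) ^ (1 + s)) :=
    calc SAW.law D.carrier δ (a δ) (b δ) (trav D.carrier δ (a δ) (b δ) 4 y η R) * ENNReal.ofReal c
        ≤ SAW.law D.carrier δ (a δ) (b δ) (trav D.carrier δ (a δ) (b δ) 4 y η R) *
            SAW.law Ω δ (a δ) (b δ) (Conf D.carrier Ω δ (a δ) (b δ)) := mul_le_mul' le_rfl hpos
      _ ≤ SAW.law Ω δ (a δ) (b δ) (trav Ω δ (a δ) (b δ) 4 y η R) := hcov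
      _ ≤ ENNReal.ofReal (C * (η / R) ^ (1 + s)) := hbig
  exact le_ofReal_div_of_mul_le hc key

/-! ### Composition, part 2: per-shell decay + coarse-mesh counting ⟹ the crux's bound -/

/-- Per-shell decay (shell-dependent mesh threshold) and the coarse-mesh count S1 give the crux's
conclusion for one `(D, a, b)` with `K = 1`, `λ = 3` and the GLOBAL mesh threshold `δ₀ = 1`: for a
genuine shell take `ε = (ρ/R)^3`, the `k₁, δ₁` of per-shell decay and the `N` of S1 at `(ρ, δ₁)`;
the threshold `max k₁ N` works for `δ ≤ δ₁` by monotonicity in `k` and for `δ > δ₁` because the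
event is empty. -/
theorem bound_of_perShellDecay (h1 : TravCountBound) (D : DobrushinDomain) (a b : ℝ → Site 2)
    (hP : PerShellDecay D a b) :
    ∃ (k : ℂ → ℝ → ℝ → ℕ) (K lam δ₀ : ℝ), 2 < lam ∧ 0 < δ₀ ∧ ∀ δ ∈ Set.Ioc (0 : ℝ) δ₀,
      ∀ (x : ℂ) (ρ R : ℝ), δ ≤ ρ → ρ < R → R ≤ 1 →
        SAW.law D.carrier δ (a δ) (b δ)
            {γ | (⟨γ.walk.toCurve (meshPoint δ)⟩ : Curve ℂ).HasTraversals (k x ρ R) x ρ R} ≤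
          ENNReal.ofReal (K * (ρ / R) ^ lam) := by
  classical
  have key : ∀ (x : ℂ) (ρ R : ℝ), ∃ k : ℕ, 0 < ρ → ρ < R → ∀ δ ∈ Set.Ioc (0 : ℝ) 1,
      SAW.law D.carrier δ (a δ) (b δ) (trav D.carrier δ (a δ) (b δ) k x ρ R) ≤
        ENNReal.ofReal ((ρ / R) ^ (3 : ℝ)) := by
    intro x ρ R
    by_cases h : 0 < ρ ∧ ρ < R
    · have hε : 0 < (ρ / R) ^ (3 : ℝ) := Real.rpow_pos_of_pos (div_pos h.1 (h.1.trans h.2)) _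
      obtain ⟨k₁, δ₁, hδ₁, hk₁⟩ := hP x ρ R h.1 h.2 _ hε
      obtain ⟨N, hN⟩ := h1 ρ δ₁ h.1 hδ₁
      refine ⟨max k₁ N, fun _ _ δ hδ => ?_⟩
      by_cases hle : δ ≤ δ₁
      · calc SAW.law D.carrier δ (a δ) (b δ) (trav D.carrier δ (a δ) (b δ) (max k₁ N) x ρ R)
            ≤ SAW.law D.carrier δ (a δ) (b δ) (trav D.carrier δ (a δ) (b δ) k₁ x ρ R) :=
              measure_mono fun γ hγ => Curve.HasTraversals.of_le hγ (le_max_left _ _)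
          _ ≤ ENNReal.ofReal ((ρ / R) ^ (3 : ℝ)) := hk₁ δ ⟨hδ.1, hle⟩
      · have hempty : trav D.carrier δ (a δ) (b δ) (max k₁ N) x ρ R = ∅ :=
          Set.eq_empty_iff_forall_notMem.2 fun γ hγ =>
            hN D.carrier δ (a δ) (b δ) γ x R (le_of_lt (not_le.1 hle)) h.2
              (Curve.HasTraversals.of_le hγ (le_max_right _ _))
        rw [hempty, measure_empty]
        exact bot_le
    · exact ⟨0, fun h1' h2' => absurd ⟨h1', h2'⟩ h⟩
  choose k hk using key
  refine ⟨k, 1, 3, 1, by norm_num, one_pos, fun δ hδ x ρ R hδρ hρR _ => ?_⟩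
  rw [one_mul]
  exact hk x ρ R (hδ.1.trans_le hδρ) hρR δ hδ

/-! ### The skeleton theorem: the six stubs imply the crux, BY NAME -/

/-- **`ShellCrossingBound` from the line `socket-comparison`** (kernel-checked, no `sorry` of its
own): for each Dobrushin domain the socket transfer (stubs S2, S4, S5 and the proved S3) yields the
two-strand pinch bound away from the marked points, the proved union bound S6 turns it into
per-shell decay, and the coarse-mesh count (stub S1) supplies the global mesh threshold;
`K = 1`, `λ = 3`, `δ₀ = 1`.  Hypothesis = the single registered stub S0 (`PinchAway` under the endpoint
approximation); S4 ∧ S5 ⟹ S0 is the proved `pinchAway_of` (S1, S2 landed). -/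
theorem ShellCrossingBound_of (hPA : Registered.stub_pinchAway) : ShellCrossingBound := by
  intro D a b hab
  exact bound_of_perShellDecay travCountBound_holds D a b
    (pinchUnionBound_holds D a b (hPA D a b hab))

/-- Wiring check 1: the single registered stub S0 feeds the skeleton theorem as stated. -/
example : ShellCrossingBound := ShellCrossingBound_of stub_pinchAway

/-- Wiring check 2 (the socket refinement, kernel-checked): the registered stubs S4, S5 together with
the LANDED S2 give S0 (`pinchAway_of`), hence the crux. -/
example : ShellCrossingBound :=
  ShellCrossingBound_of fun D a b hab =>
    pinchAway_of socketNesting_holds stub_socketConfinement stub_socketPinchBound D a b hab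

/-! ### By-products recorded for the lead (sorry-free)

* The transfer also serves the route's TARGET directly (card, "Disproof used (b)"): the same three
  stubs S2–S4 turn tightness of the pushed laws of the socketed disc into tightness for `D'`
  (domination by `1/c` on complements of compacts).  Not needed by the skeleton; not stated.
* Sub-socket shells: `socketDomain D L r ∩ ball (D.pt 0) r = D.carrier ∩ ball (D.pt 0) r`
  (`socketDomain_inter_ball_left`), the structural fact behind S4. -/

/-- Inside the open socket ball about `a` the socketed disc coincides with the original domain. -/
theorem socketDomain_inter_ball_left (D : DobrushinDomain) (L r : ℝ) :
    socketDomain D L r ∩ ball (D.pt 0) r = D.carrier ∩ ball (D.pt 0) r := by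
  ext z
  simp only [socketDomain, mem_inter_iff, mem_union, Set.mem_sdiff, mem_closedBall, mem_ball, not_or,
    not_le]
  constructor
  · rintro ⟨h | ⟨-, h1, -⟩, hz⟩
    · exact ⟨h, hz⟩
    · exact absurd hz (not_lt.2 h1.le)
  · rintro ⟨h, hz⟩
    exact ⟨Or.inl h, hz⟩

/-- Inside the open socket ball about `b` the socketed disc coincides with the original domain. -/
theorem socketDomain_inter_ball_right (D : DobrushinDomain) (L r : ℝ) :
    socketDomain D L r ∩ ball (D.pt 1) r = D.carrier ∩ ball (D.pt 1) r := by
  ext z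
  simp only [socketDomain, mem_inter_iff, mem_union, Set.mem_sdiff, mem_closedBall, mem_ball, not_or,
    not_le]
  constructor
  · rintro ⟨h | ⟨-, -, h2⟩, hz⟩
    · exact ⟨h, hz⟩
    · exact absurd hz (not_lt.2 h2.le)
  · rintro ⟨h, hz⟩
    exact ⟨Or.inl h, hz⟩

/-- The original domain is part of its socketed disc. -/
theorem subset_socketDomain (D : DobrushinDomain) (L r : ℝ) : D.carrier ⊆ socketDomain D L r :=
  subset_union_left

/-- The obstacle `Ω ∖ D'` keeps distance `≥ r` from both marked points. -/
theorem le_dist_of_mem_socketDomain_diff (D : DobrushinDomain) (L r : ℝ) {z : ℂ}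
    (hz : z ∈ socketDomain D L r \ D.carrier) :
    r < dist z (D.pt 0) ∧ r < dist z (D.pt 1) := by
  obtain ⟨hz, hzD⟩ := hz
  rcases hz with h | ⟨-, h⟩
  · exact absurd h hzD
  · simp only [mem_union, mem_closedBall, not_or, not_le] at h
    exact h

/-! ### Negative knowledge checked against (landed `Theorems/ShellCrossingBound/Negative/*`) -/

/-- The refuted UNIFORM-threshold statement (one `k` for all shells, incl. those at the marked
point): recorded here so that no stub drifts into an instance of it — `SocketPinchBound` fixes
`k = 4` only `3r`-away from the marked points, in the socketed disc. -/
example : ¬ (∀ (D : DobrushinDomain) (a b : ℝ → Site 2), SAW.IsEndpointApprox D a b →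
    ∃ (k : ℕ) (K lam δ₀ : ℝ), 2 < lam ∧ 0 < δ₀ ∧ ∀ δ ∈ Set.Ioc (0 : ℝ) δ₀,
      ∀ (x : ℂ) (ρ R : ℝ), δ ≤ ρ → ρ < R → R ≤ 1 →
        SAW.law D.carrier δ (a δ) (b δ)
          {γ | (⟨γ.walk.toCurve (meshPoint δ)⟩ : Curve ℂ).HasTraversals k x ρ R}
            ≤ ENNReal.ofReal (K * (ρ / R) ^ lam)) :=
  Theorems.ShellCrossingBound.Negative.not_uniformThreshold

/-- Calibration (landed): the target already implies the crux — any line must put its content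
elsewhere (here: the fixed threshold `4` of S5). -/
example (hT : Theses.SAWRenewalTightness.EventualTight) : ShellCrossingBound := by
  intro D a b hab
  obtain ⟨δ₀, hδ₀, htight⟩ := hT D a b hab
  obtain ⟨k, hk⟩ :=
    Theorems.ShellCrossingBound.Negative.bound_of_isTightMeasureSet D a b _ htight
  exact ⟨k, 1, 3, δ₀, by norm_num, hδ₀, fun δ hδ x ρ R hδρ hρR _ =>
    hk δ hδ x ρ R (hδ.1.trans_le hδρ) hρR⟩

end Summit.CriticalPhenomena.SAWScalingLimit.Cruxes.ShellCrossingBound.SocketComparison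

end
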